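/-
Copyright (c) 2026 the pub-hodgecm2 formalisation cell (harness21).  New file, outside the frozen port manifest.
Origin: seat `prover-pub-hodgecm2-d2bridge-socket-1-g0-0` (SOCKET-SPEC seat; the coordinator's CONJ-PROBE, HOME/INBOX l.11538), 2026-08-23.
KERNEL lane: theorems only, no `def`, no instance, no named fact, no `sorry`.  HC_CM is NOT proved; NOT «Δ2 BRIDGE CLOSED».
-/
import Summits.HodgeConjecture.HodgeCM.Model.LiuIndexCentralType_1
import HarnessLib

set_option autoImplicit false

/-!
# The conjugate tag `ῑ₁ := conj ∘ ι₁`: the ARCHIMEDEAN FRAME DATA of the pin are conj-INVARIANT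

Companion of ✔ `CorCM/D2Bridge/OrientationMuLiuConj.lean` (wb-8: the place, `𝟙_{w₁}`, the FLIP of Liu's weight-one table `muLiu` and of
the guard `PhiMuLine` under `ι₁ ↦ ῑ₁`).  Here the complementary NON-flips: the consumer's sign convention `cmSignConv L dV ι₁` reads the
distinguished embedding only through its PLACE `mk ι₁ = mk ῑ₁` and through `re ∘ ι₁` on the (real) frame entries (`re (conj z) = re z`), so it —
and with it the canonical scalings `cmDV ∕ cmCW ∕ cmDW` and the scaled Folland frame `cmBigFrame` of the pin (hence the archimedean Gaussian and
the central-type predicate over a fixed Gram matrix) — is UNCHANGED by conjugating the tag.  Kernel input for the orientation re-key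
(coordinator VERDICT MIS-KEY ∕ (c-S), 2026-08-23): among the index data only `muLiu`'s sign and the guard flip; the frame does not.
-/

noncomputable section

namespace Summit.HodgeConjecture.CorCM.D2Bridge.ConjTag

open NumberField NumberField.InfinitePlace
open HodgeCM HodgeCM.Model

/-! ## The archimedean frame data are conj-invariant -/

section Frame

variable (L : Type) [Field L] [NumberField L] [IsCMField L] {N M n : ℕ} (e : Fin N × Fin M ≃ Fin n)
variable (dV : Fin N → L) (hdV : ∀ i, IsCMField.complexConj L (dV i) = dV i) (hdV0 : ∀ i, dV i ≠ 0)
variable (dW : Fin M → L) (hdW : ∀ i, IsCMField.complexConj L (dW i) = dW i) (hdW0 : ∀ i, dW i ≠ 0) (ι₁ : L →+* ℂ)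

/-- **the consumer's sign convention is conj-invariant**: it reads `ι₁` only through the place `mk ι₁` and through `re ∘ ι₁` on the
(real) frame entries, and `re (conj z) = re z`. [folklore] -/
theorem cmSignConv_conj :
    Literature.NumberTheory.Weil1964.cmSignConv L dV ((starRingEnd ℂ).comp ι₁) = Literature.NumberTheory.Weil1964.cmSignConv L dV ι₁ := by
  have hmk : NumberField.InfinitePlace.mk ((starRingEnd ℂ).comp ι₁) = NumberField.InfinitePlace.mk ι₁ :=
    NumberField.InfinitePlace.mk_conjugate_eq ι₁
  funext v
  unfold Literature.NumberTheory.Weil1964.cmSignConv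
  rw [hmk]
  simp only [RingHom.coe_comp, Function.comp_apply, Complex.conj_re]

/-- the canonical `V`-scaling `√|x_V|` is conj-invariant. [folklore] -/
theorem cmDV_conj : HypCensus.cmDV L dV hdV ((starRingEnd ℂ).comp ι₁) = HypCensus.cmDV L dV hdV ι₁ := by
  funext v i
  simp only [HypCensus.cmDV, HypCensus.cmXV, cmSignConv_conj]

/-- the `W`-side scalar `c_W` is conj-invariant. [folklore] -/
theorem cmCW_conj : HypCensus.cmCW L dV ((starRingEnd ℂ).comp ι₁) = HypCensus.cmCW L dV ι₁ := by
  funext v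
  simp only [HypCensus.cmCW, cmSignConv_conj]

/-- the canonical `W`-scaling `√|x_W|` is conj-invariant. [folklore] -/
theorem cmDW_conj : HypCensus.cmDW L dV dW hdW ((starRingEnd ℂ).comp ι₁) = HypCensus.cmDW L dV dW hdW ι₁ := by
  funext v j
  simp only [HypCensus.cmDW, HypCensus.cmXW, cmCW_conj]

include hdV0 hdW0 in
/-- **the scaled Folland frame of the pin is conj-invariant.** [folklore] -/
theorem cmBigFrame_conj :
    HypCensus.cmBigFrame L e dV hdV hdV0 dW hdW hdW0 ((starRingEnd ℂ).comp ι₁) = HypCensus.cmBigFrame L e dV hdV hdV0 dW hdW hdW0 ι₁ := by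
  simp only [HypCensus.cmBigFrame, cmDV_conj, cmDW_conj]

end Frame

end Summit.HodgeConjecture.CorCM.D2Bridge.ConjTag

end
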